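import Literature.Algebra.EuclideanLattices.SmoothingParameterBounds
import Literature.Algebra.EuclideanLattices.LatticeGeometryTransference
import Literature.Algebra.EuclideanLattices.SuccessiveMinimaMinNormPos
import HarnessLib

/-!
# Regev 2009, Claim 2.13: the lower bound `η_ε(L) ≥ √(ln(1/ε)/π) / λ₁(L*) ≥ √(ln(1/ε)/π) λₙ(L)/n`

Topic `Algebra/EuclideanLattices` (family `pqc`). Serves the decomposition of the named fact
`Literature.Computability.Cryptography.regev_lwe_to_sivp_quantum` (pqc.S19; Regev, J. ACM 56 (2009),
Thm 1.1), step `GIVP_{2√n φ} ≤ DGS_φ` (Lemma 3.17): the claim is what guarantees that one of the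
`2n + 1` radii `rᵢ = λ̃ₙ 2^{-i}` tried by that reduction satisfies `φ(L) < rᵢ ≤ 2 φ(L)`
("Such an `i` must exist by Claim 2.13", p. 21).

**Claim 2.13** (Regev 2009, p. 14). *For any lattice `L` and any `ε > 0`,
`η_ε(L) ≥ √(ln(1/ε)/π) · 1/λ₁(L*) ≥ √(ln(1/ε)/π) · λₙ(L)/n`.*
Printed proof: "Let `v ∈ L*` be a vector of length `λ₁(L*)` and let `s = η_ε(L)`. Then
`ε = ρ_{1/s}(L* ∖ {0}) ≥ ρ_{1/s}(v) = exp(-π (s λ₁(L*))²)`. The first inequality follows by solving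
for `s`. The second inequality is by Lemma 2.3" (Banaszczyk's transference `λ₁(L*) λₙ(L) ≤ n`, the
tree theorem `successiveMinimum_mul_dual_le_holds`).

Everything here is PROVED; theorems only, no named facts. The first inequality is proved for every
`s` in the defining set of `η_ε` (so no attainment is needed, `le_smoothingParameter_iff_holds`).

## Main results

* `Regev2009.sqrt_log_div_minNorm_dual_le_smoothingParameter` — `√(ln(1/ε)/π)/λ₁(L*) ≤ η_ε(L)`
  (`0 < ε`, nontrivial space).
* `Regev2009.successiveMinimum_mul_minNorm_dual_le`, `Regev2009.successiveMinimum_div_le_one_div_minNorm_dual`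
  — `λₙ(L) λ₁(L*) ≤ n`, `λₙ(L)/n ≤ 1/λ₁(L*)` (transference).
* `Regev2009.claim_2_13` — `√(ln(1/ε)/π) · λₙ(L)/n ≤ η_ε(L)`.
* `Regev2009.successiveMinimum_le_mul_smoothingParameter` — for `0 < ε ≤ 1/10`:
  `λₙ(L) ≤ (5/4) n η_ε(L)` (the form consumed by the radius search of Lemma 3.17).

## References

* O. Regev, *On lattices, learning with errors, random linear codes, and cryptography*, J. ACM 56
  (2009), art. 34 (author's version arXiv:2401.03703), Claim 2.13 (p. 14), Lemma 2.3, Lemma 3.17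
  [Regev2009].
* W. Banaszczyk, *New bounds in some transference theorems in the geometry of numbers*,
  Math. Ann. 296 (1993), Thm 2.1 [Banaszczyk1993].
* D. Micciancio, O. Regev, *Worst-case to average-case reductions based on Gaussian measures*,
  SIAM J. Comput. 37 (2007), Def. 3.1 [MicciancioRegev2007].
-/

noncomputable section

open Module
open scoped Real ENNReal

namespace Literature.Algebra.EuclideanLattices

namespace Regev2009

variable {V : Type*} [NormedAddCommGroup V] [InnerProductSpace ℝ V] [FiniteDimensional ℝ V]
  (L : Submodule ℤ V) [DiscreteTopology L] [IsZLattice ℝ L]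

/-- **The computation of the printed proof**: if `s > 0` is admissible for `η_ε`, i.e.
`ρ_{1/s}(L* ∖ {0}) ≤ ε`, then `exp(-π (s λ₁(L*))²) ≤ ε` (the single term `v` of length `λ₁(L*)`).
[cite: Regev2009, Claim 2.13 (proof)] -/
theorem exp_neg_pi_mul_sq_le_of_gaussianMass_dual_le [Nontrivial V] {ε s : ℝ} (hs : 0 < s)
    (hmass : gaussianMass (1 / s) 0 ((dualLattice L : Set V) \ {0}) ≤ ENNReal.ofReal ε) :
    Real.exp (-π * (s * minNorm (dualLattice L)) ^ 2) ≤ ε := by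
  obtain ⟨v, hv, hv0, hvn⟩ :=
    exists_mem_norm_eq_minNorm_holds (dualLattice L) (dualLattice_ne_bot L)
  -- the single term `v` of the mass
  have hterm : ENNReal.ofReal (gaussianFunction (1 / s) (v - 0)) ≤
      gaussianMass (1 / s) 0 ((dualLattice L : Set V) \ {0}) := by
    unfold gaussianMass
    exact ENNReal.le_tsum (f := fun x : ((dualLattice L : Set V) \ {0} : Set V) =>
      ENNReal.ofReal (gaussianFunction (1 / s) ((x : V) - 0))) ⟨v, hv, hv0⟩
  have h := hterm.trans hmass
  have hε : 0 ≤ ε := by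
    by_contra hneg
    rw [not_le] at hneg
    rw [ENNReal.ofReal_of_nonpos hneg.le, nonpos_iff_eq_zero, ENNReal.ofReal_eq_zero] at h
    exact absurd h (not_le.2 (gaussianFunction_pos _ _))
  rw [ENNReal.ofReal_le_ofReal_iff hε, sub_zero] at h
  convert h using 2
  rw [gaussianFunction, hvn]
  congr 1
  field_simp

/-- **Regev 2009, Claim 2.13, first inequality**: `√(ln(1/ε)/π) / λ₁(L*) ≤ η_ε(L)` for a full-rank
lattice `L` of a nontrivial space and `0 < ε` ("the first inequality follows by solving for `s`";
for `ε ≥ 1` the left side is `0`). [cite: Regev2009, Claim 2.13] -/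
theorem sqrt_log_div_minNorm_dual_le_smoothingParameter [Nontrivial V] {ε : ℝ} (hε : 0 < ε) :
    Real.sqrt (Real.log (1 / ε) / π) / minNorm (dualLattice L) ≤ smoothingParameter L ε := by
  have hl : 0 < minNorm (dualLattice L) := minNorm_pos_of_ne_bot _ (dualLattice_ne_bot L)
  rw [le_smoothingParameter_iff_holds L hε]
  intro s hs hmass
  have h := exp_neg_pi_mul_sq_le_of_gaussianMass_dual_le L hs hmass
  -- solve for `s`: `ln(1/ε) ≤ π (s λ₁)²`
  have hlog : Real.log (1 / ε) ≤ π * (s * minNorm (dualLattice L)) ^ 2 := by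
    have h1 := Real.log_le_log (Real.exp_pos _) h
    rw [Real.log_exp] at h1
    rw [one_div, Real.log_inv]
    linarith
  rw [div_le_iff₀ hl]
  calc Real.sqrt (Real.log (1 / ε) / π) ≤ Real.sqrt ((s * minNorm (dualLattice L)) ^ 2) := by
        apply Real.sqrt_le_sqrt
        rw [div_le_iff₀ Real.pi_pos]
        linarith
    _ = s * minNorm (dualLattice L) := Real.sqrt_sq (by positivity)

/-- **Regev 2009, Claim 2.13, second inequality (transference)**: `λₙ(L)/n ≤ 1/λ₁(L*)`, i.e.
`λₙ(L) λ₁(L*) ≤ n` (Lemma 2.3 = Banaszczyk 1993, Thm 2.1, applied to `L*` with `L** = L`; the tree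
theorem `successiveMinimum_mul_dual_le_holds`). For the zero space both sides vanish.
[cite: Regev2009, Claim 2.13; Banaszczyk1993, Thm 2.1] -/
theorem successiveMinimum_mul_minNorm_dual_le :
    successiveMinimum L (finrank ℝ V) * minNorm (dualLattice L) ≤ finrank ℝ V := by
  rcases Nat.eq_zero_or_pos (finrank ℝ V) with h0 | hpos
  · rw [h0, successiveMinimum_zero, zero_mul, Nat.cast_zero]
  · have h := successiveMinimum_mul_dual_le_holds (dualLattice L) (i := 1) le_rfl hpos
    rw [successiveMinimum_one_eq_minNorm_holds, Nat.add_sub_cancel, dualLattice_dualLattice] at h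
    linarith [mul_comm (minNorm (dualLattice L)) (successiveMinimum L (finrank ℝ V))]

/-- `λₙ(L)/n ≤ 1/λ₁(L*)` in a nontrivial space. [cite: Regev2009, Claim 2.13] -/
theorem successiveMinimum_div_le_one_div_minNorm_dual [Nontrivial V] :
    successiveMinimum L (finrank ℝ V) / finrank ℝ V ≤ 1 / minNorm (dualLattice L) := by
  have hl : 0 < minNorm (dualLattice L) := minNorm_pos_of_ne_bot _ (dualLattice_ne_bot L)
  have hn : (0 : ℝ) < finrank ℝ V := by exact_mod_cast Module.finrank_pos
  rw [div_le_div_iff₀ hn hl, one_mul]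
  exact successiveMinimum_mul_minNorm_dual_le L

/-- **Regev 2009, Claim 2.13 (as printed, second form).** *For any lattice `L` and any `ε > 0`,
`η_ε(L) ≥ √(ln(1/ε)/π) · λₙ(L)/n`* (full-rank `L` in an `n`-dimensional space, `n ≥ 1`).
[cite: Regev2009, Claim 2.13] -/
theorem claim_2_13 [Nontrivial V] {ε : ℝ} (hε : 0 < ε) :
    Real.sqrt (Real.log (1 / ε) / π) * (successiveMinimum L (finrank ℝ V) / finrank ℝ V) ≤
      smoothingParameter L ε := by
  refine le_trans ?_ (sqrt_log_div_minNorm_dual_le_smoothingParameter L hε)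
  rw [div_eq_mul_one_div (Real.sqrt _)]
  exact mul_le_mul_of_nonneg_left (successiveMinimum_div_le_one_div_minNorm_dual L) (Real.sqrt_nonneg _)

/-- **The form used by Lemma 3.17**: for `0 < ε ≤ 1/10` (so `√(ln(1/ε)/π) ≥ √(ln 10/π) > 4/5`),
`λₙ(L) ≤ (5/4) n η_ε(L)`. [cite: Regev2009, Claim 2.13 with Lemma 3.17 (proof)] -/
theorem successiveMinimum_le_mul_smoothingParameter [Nontrivial V] {ε : ℝ} (hε : 0 < ε)
    (hε10 : ε ≤ 1 / 10) :
    successiveMinimum L (finrank ℝ V) ≤ 5 / 4 * finrank ℝ V * smoothingParameter L ε := by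
  have hn : (0 : ℝ) < finrank ℝ V := by exact_mod_cast Module.finrank_pos
  have h := claim_2_13 L hε
  -- `4/5 ≤ √(ln(1/ε)/π)`: `ln(1/ε) ≥ ln 10 > 2.30 > π · 16/25`
  have hc : 4 / 5 ≤ Real.sqrt (Real.log (1 / ε) / π) := by
    rw [Real.le_sqrt' (by norm_num), le_div_iff₀ Real.pi_pos]
    have h10 : Real.log 10 ≤ Real.log (1 / ε) := by
      apply Real.log_le_log (by norm_num)
      rw [le_div_iff₀ hε]; linarith
    -- `2.02 ≤ ln 10` since `e^{2.02} = e² · e^{0.02} < 7.39 · 1.021 < 10`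
    have hlog10 : (2.02 : ℝ) ≤ Real.log 10 := by
      rw [Real.le_log_iff_exp_le (by norm_num)]
      have he := Real.exp_one_lt_d9
      have h23 : Real.exp 2.02 = Real.exp 1 ^ 2 * Real.exp 0.02 := by
        rw [← Real.exp_nat_mul, ← Real.exp_add]; norm_num
      have h03 : Real.exp 0.02 ≤ 1.021 := by
        have := Real.exp_bound_div_one_sub_of_interval' (x := 0.02) (by norm_num) (by norm_num)
        norm_num at this
        linarith [this]
      rw [h23]
      nlinarith [Real.exp_pos 0.02, Real.exp_pos 1]
    nlinarith [Real.pi_lt_d4]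
  have hsm : 0 ≤ successiveMinimum L (finrank ℝ V) / finrank ℝ V :=
    div_nonneg (successiveMinimum_nonneg _ _) hn.le
  have h2 : 4 / 5 * (successiveMinimum L (finrank ℝ V) / finrank ℝ V) ≤ smoothingParameter L ε :=
    (mul_le_mul_of_nonneg_right hc hsm).trans h
  have h3 : successiveMinimum L (finrank ℝ V) / finrank ℝ V ≤ 5 / 4 * smoothingParameter L ε := by
    linarith
  rw [div_le_iff₀ hn] at h3
  linarith

end Regev2009

end Literature.Algebra.EuclideanLattices

end
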